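import Summits.QuantumFields.YangMills.Theorems.BrascampLiebVacuum.Negative.DmaxVolumeBound

/-!
# `ConvexGribovBody.BrascampLiebVacuumSC` — negative lane: the `Dmax` integrand is measurable
# (refuter / standing disprover, crux stmt-QuantumFields-16404; anti-junk certificate)

The covariance scale of the crux
`Summit.QuantumFields.YangMills.Theses.ConvexGribovBody.BrascampLiebVacuumSC` (and of the siblings
`BrascampLiebVacuum`, `CovarianceBound`) is
`Dmax = ⨆_p ∫ (⨆_{h ∈ argmin coul(U, ·)} cov(U, h, p)) dμ(U)` — a supremum over the (generally
infinite) set of minimisers of the lattice Coulomb functional INSIDE a Bochner integral. Lean's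
`∫` returns the junk value `0` for a non-(ae-strongly-)measurable integrand; were that the case,
`Dmax = 0` and the crux would be false for a junk reason (`Var ≤ 0` for the plaquette trace,
contradicting `Negative/PlaquetteVarianceFloor.lean`). This file closes that door and, at the
same time, supplies what every LOWER bound on `Dmax` needs (`integral_mono` requires the larger
integrand to be integrable; the landed upper bound `dmax_le_volume` did not):

* `measurable_iSup_argmin` — Berge-type lemma: `X` a topological space with measurable open
  sets, `K` compact non-empty, `F, c : X × K → ℝ` continuous; then
  `x ↦ sup {c(x, h) | h ∈ argmin F(x, ·)}` is measurable — every super-level set `{t ≤ sup}` is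
  the projection along the compact factor of a closed subset of `X × K` (the sup is attained on
  the compact argmin), hence closed (`isClosedMap_fst_of_compactSpace`); `measurable_of_Ici`.
* `measurable_dmaxIntegrand` — the crux's integrand `U ↦ ⨆_{h ∈ argmin} cov(U, h, p)` is
  measurable (the Coulomb functional and the covariance density are continuous in `(U, h)`;
  `G ↪ U(N)` is second countable, so Borel = product σ-algebra on configurations).
* `integrable_dmaxIntegrand` — and integrable under Wilson's measure (bounded by `3N(2S+1)³`).

Everything proved (axioms `propext`, `Classical.choice`, `Quot.sound`); nothing here asserts a
Theses statement. Reference for the mathematics: C. Berge, *Topological Spaces* (1963), Ch. VI §3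
(maximum theorem) — only the closed-projection half is needed.
-/

noncomputable section

open scoped BigOperators Topology Matrix
open Filter MeasureTheory Function Set
open Literature.MathematicalPhysics.QuantumFieldTheory
open Summit.QuantumFields.YangMills.Theorems.BrascampLiebVacuum.Negative

namespace Summit.QuantumFields.YangMills.Theorems.BrascampLiebVacuumSC.Negative

section General

/-- **Measurability of a sup over an argmin** (Berge): `X` a topological measurable space whose
open sets are measurable, `K` compact non-empty, `F, c : X × K → ℝ` continuous. Then
`x ↦ sup {c(x, h) | h minimises F(x, ·)}` is measurable — indeed every super-level set
`{x | t ≤ sup}` is the projection of a closed subset of `X × K`, hence closed. [folklore] -/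
theorem measurable_iSup_argmin {X K : Type*} [TopologicalSpace X] [MeasurableSpace X]
    [OpensMeasurableSpace X] [TopologicalSpace K] [CompactSpace K] [Nonempty K]
    {F c : X → K → ℝ} (hF : Continuous (uncurry F)) (hc : Continuous (uncurry c)) :
    Measurable fun x => ⨆ h : {h : K // ∀ h', F x h ≤ F x h'}, c x h.1 := by
  -- pointwise structure: the argmin is non-empty and compact, the sup is attained
  have hFx : ∀ x, Continuous (F x) := fun x => hF.comp (Continuous.prodMk_right x)
  have hcx : ∀ x, Continuous (c x) := fun x => hc.comp (Continuous.prodMk_right x)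
  have hne : ∀ x, ∃ h : K, ∀ h', F x h ≤ F x h' := fun x => by
    obtain ⟨h, -, hmin⟩ := isCompact_univ.exists_isMinOn univ_nonempty (hFx x).continuousOn
    exact ⟨h, fun h' => hmin (mem_univ h')⟩
  have hbdd : ∀ x, BddAbove (range fun h : {h : K // ∀ h', F x h ≤ F x h'} => c x h.1) := by
    intro x
    obtain ⟨M, hM⟩ := isCompact_univ.bddAbove_image (hcx x).continuousOn
    refine ⟨M, ?_⟩
    rintro _ ⟨h, rfl⟩
    exact hM ⟨h.1, mem_univ _, rfl⟩
  -- super-level sets are projections of closed sets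
  have hlevel : ∀ t : ℝ, {x | t ≤ ⨆ h : {h : K // ∀ h', F x h ≤ F x h'}, c x h.1} =
      Prod.fst '' {q : X × K | (∀ h', F q.1 q.2 ≤ F q.1 h') ∧ t ≤ c q.1 q.2} := by
    intro t
    ext x
    simp only [mem_setOf_eq, mem_image, Prod.exists, exists_and_right, exists_eq_right]
    constructor
    · intro ht
      -- the sup is attained on the compact argmin
      have hcl : IsClosed {h : K | ∀ h', F x h ≤ F x h'} := by
        have : {h : K | ∀ h', F x h ≤ F x h'} = ⋂ h', {h | F x h ≤ F x h'} := by
          ext h; simp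
        rw [this]
        exact isClosed_iInter fun h' => isClosed_le (hFx x) continuous_const
      obtain ⟨h₀, hh₀⟩ := hne x
      obtain ⟨h₁, hh₁, hmax⟩ := hcl.isCompact.exists_isMaxOn ⟨h₀, hh₀⟩ (hcx x).continuousOn
      refine ⟨h₁, hh₁, ht.trans ?_⟩
      haveI : Nonempty {h : K // ∀ h', F x h ≤ F x h'} := ⟨⟨h₀, hh₀⟩⟩
      exact ciSup_le fun h => hmax h.2
    · rintro ⟨h, hh, ht⟩
      exact ht.trans (le_ciSup (hbdd x) ⟨h, hh⟩)
  have hclosed : ∀ t : ℝ, IsClosed {q : X × K | (∀ h', F q.1 q.2 ≤ F q.1 h') ∧ t ≤ c q.1 q.2} := by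
    intro t
    have h1 : IsClosed {q : X × K | ∀ h', F q.1 q.2 ≤ F q.1 h'} := by
      have : {q : X × K | ∀ h', F q.1 q.2 ≤ F q.1 h'} = ⋂ h', {q | F q.1 q.2 ≤ F q.1 h'} := by
        ext q; simp
      rw [this]
      refine isClosed_iInter fun h' => isClosed_le hF ?_
      exact hF.comp (continuous_fst.prodMk continuous_const)
    exact h1.inter (isClosed_le continuous_const hc)
  refine measurable_of_Ici fun t => ?_
  have : (fun x => ⨆ h : {h : K // ∀ h', F x h ≤ F x h'}, c x h.1) ⁻¹' Ici t =
      {x | t ≤ ⨆ h : {h : K // ∀ h', F x h ≤ F x h'}, c x h.1} := rfl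
  rw [this, hlevel t]
  exact ((isClosedMap_fst_of_compactSpace _ (hclosed t))).measurableSet


end General

section Crux

variable {G : Type*} [Group G] [TopologicalSpace G] [IsTopologicalGroup G] [CompactSpace G]
  [MeasurableSpace G] [BorelSpace G]

/-- **The `Dmax` integrand of the crux is measurable**: for every torus, coupling-free data
`(r, S)` and momentum `p`, `U ↦ sup_{h ∈ argmin coul(U, ·)} cov(U, h, p)` (crux vocabulary
verbatim) is a measurable function of the configuration — so `∫ (⨆ h, cov) ∂μ` in `Dmax` is a
genuine integral (not Lean's junk `0` for non-measurable integrands) and LOWER bounds on `Dmax`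
can be proved by `integral_mono`. [folklore] -/
theorem measurable_dmaxIntegrand (r : LatticeRep G) (S : ℕ) (p : Fin 3 → ZMod (2 * S + 1)) :
    let fro : Matrix (Fin r.N) (Fin r.N) ℂ → ℝ := fun M => ∑ a, ∑ b, ‖M a b‖ ^ 2
    let coul : GaugeConfig 4 (2 * S + 1) G → (Site 4 (2 * S + 1) → G) → ℝ := fun U h =>
      -∑ e : Edge 4 (2 * S + 1),
        (if e.1 0 = 0 ∧ e.2 ≠ 0 then (r.ρ (gaugeTransform h U e)).trace.re else 0)
    let cov : GaugeConfig 4 (2 * S + 1) G → (Site 4 (2 * S + 1) → G) →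
        (Fin 3 → ZMod (2 * S + 1)) → ℝ := fun U h p =>
      (∑ j : Fin 3, fro (∑ y : Fin 3 → ZMod (2 * S + 1),
        Complex.exp (-(2 * Real.pi * Complex.I *
          (∑ i : Fin 3, ((p i).val : ℂ) * ((y i).val : ℂ)) / (2 * S + 1 : ℂ))) •
        ((1 / 2 : ℂ) • (r.ρ (gaugeTransform h U (Fin.cons (0 : ZMod (2 * S + 1)) y, j.succ)) -
          (r.ρ (gaugeTransform h U (Fin.cons (0 : ZMod (2 * S + 1)) y, j.succ)))ᴴ)))) /
        ((2 * S + 1 : ℝ) ^ 3)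
    Measurable fun U : GaugeConfig 4 (2 * S + 1) G =>
      ⨆ h : {h : Site 4 (2 * S + 1) → G // ∀ h', coul U h ≤ coul U h'}, cov U h.1 p := by
  intro fro coul cov
  haveI : SecondCountableTopology G :=
    (r.continuous.isClosedEmbedding r.injective).isEmbedding.secondCountableTopology
  -- continuity of the gauge-transformed link as a function of `(U, h)`
  have hgt : ∀ e : Edge 4 (2 * S + 1), Continuous fun q : GaugeConfig 4 (2 * S + 1) G ×
      (Site 4 (2 * S + 1) → G) => gaugeTransform q.2 q.1 e := by
    intro e
    simp only [gaugeTransform]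
    fun_prop
  have hρgt : ∀ e : Edge 4 (2 * S + 1), Continuous fun q : GaugeConfig 4 (2 * S + 1) G ×
      (Site 4 (2 * S + 1) → G) => r.ρ (gaugeTransform q.2 q.1 e) := fun e =>
    r.continuous.comp (hgt e)
  have hcoul : Continuous (uncurry coul) := by
    change Continuous fun q : GaugeConfig 4 (2 * S + 1) G × (Site 4 (2 * S + 1) → G) =>
      -∑ e : Edge 4 (2 * S + 1),
        (if e.1 0 = 0 ∧ e.2 ≠ 0 then (r.ρ (gaugeTransform q.2 q.1 e)).trace.re else 0)
    refine (continuous_finsetSum _ fun e _ => ?_).neg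
    split_ifs
    · exact Complex.continuous_re.comp (Continuous.matrix_trace (hρgt e))
    · exact continuous_const
  have hfro : Continuous fro := by
    change Continuous fun M : Matrix (Fin r.N) (Fin r.N) ℂ => ∑ a, ∑ b, ‖M a b‖ ^ 2
    refine continuous_finsetSum _ fun a _ => continuous_finsetSum _ fun b _ => ?_
    exact ((continuous_apply_apply a b).norm).pow 2
  have hcov : Continuous (uncurry fun U h => cov U h p) := by
    change Continuous fun q : GaugeConfig 4 (2 * S + 1) G × (Site 4 (2 * S + 1) → G) =>
      (∑ j : Fin 3, fro (∑ y : Fin 3 → ZMod (2 * S + 1),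
        Complex.exp (-(2 * Real.pi * Complex.I *
          (∑ i : Fin 3, ((p i).val : ℂ) * ((y i).val : ℂ)) / (2 * S + 1 : ℂ))) •
        ((1 / 2 : ℂ) • (r.ρ (gaugeTransform q.2 q.1 (Fin.cons (0 : ZMod (2 * S + 1)) y, j.succ)) -
          (r.ρ (gaugeTransform q.2 q.1 (Fin.cons (0 : ZMod (2 * S + 1)) y, j.succ)))ᴴ)))) /
        ((2 * S + 1 : ℝ) ^ 3)
    refine (continuous_finsetSum _ fun j _ => hfro.comp ?_).div_const _
    refine continuous_finsetSum _ fun y _ => ?_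
    have h1 : Continuous fun q : GaugeConfig 4 (2 * S + 1) G × (Site 4 (2 * S + 1) → G) =>
        r.ρ (gaugeTransform q.2 q.1 (Fin.cons (0 : ZMod (2 * S + 1)) y, j.succ)) -
          (r.ρ (gaugeTransform q.2 q.1 (Fin.cons (0 : ZMod (2 * S + 1)) y, j.succ)))ᴴ :=
      (hρgt _).sub (Continuous.matrix_conjTranspose (hρgt _))
    exact (h1.const_smul ((1 / 2 : ℂ))).const_smul
      (Complex.exp (-(2 * Real.pi * Complex.I *
        (∑ i : Fin 3, ((p i).val : ℂ) * ((y i).val : ℂ)) / (2 * S + 1 : ℂ))))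
  haveI : Nonempty (Site 4 (2 * S + 1) → G) := ⟨fun _ => 1⟩
  exact measurable_iSup_argmin hcoul hcov


/-- **The `Dmax` integrand is integrable under Wilson's measure** (measurable and bounded by
`3N(2S+1)³`, cf. `dmax_le_volume`): `Dmax` is a genuine expectation, and `integral_mono` /
`integral_finset_sum` apply to it. [folklore] -/
theorem integrable_dmaxIntegrand (r : LatticeRep G) (β : ℝ) (S : ℕ) (p : Fin 3 → ZMod (2 * S + 1)) :
    let μ := wilsonMeasure (d := 4) (L := 2 * S + 1) r.ρ β
    let fro : Matrix (Fin r.N) (Fin r.N) ℂ → ℝ := fun M => ∑ a, ∑ b, ‖M a b‖ ^ 2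
    let coul : GaugeConfig 4 (2 * S + 1) G → (Site 4 (2 * S + 1) → G) → ℝ := fun U h =>
      -∑ e : Edge 4 (2 * S + 1),
        (if e.1 0 = 0 ∧ e.2 ≠ 0 then (r.ρ (gaugeTransform h U e)).trace.re else 0)
    let cov : GaugeConfig 4 (2 * S + 1) G → (Site 4 (2 * S + 1) → G) →
        (Fin 3 → ZMod (2 * S + 1)) → ℝ := fun U h p =>
      (∑ j : Fin 3, fro (∑ y : Fin 3 → ZMod (2 * S + 1),
        Complex.exp (-(2 * Real.pi * Complex.I *
          (∑ i : Fin 3, ((p i).val : ℂ) * ((y i).val : ℂ)) / (2 * S + 1 : ℂ))) •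
        ((1 / 2 : ℂ) • (r.ρ (gaugeTransform h U (Fin.cons (0 : ZMod (2 * S + 1)) y, j.succ)) -
          (r.ρ (gaugeTransform h U (Fin.cons (0 : ZMod (2 * S + 1)) y, j.succ)))ᴴ)))) /
        ((2 * S + 1 : ℝ) ^ 3)
    Integrable (fun U : GaugeConfig 4 (2 * S + 1) G =>
      ⨆ h : {h : Site 4 (2 * S + 1) → G // ∀ h', coul U h ≤ coul U h'}, cov U h.1 p) μ := by
  intro μ fro coul cov
  haveI : SecondCountableTopology G :=
    (r.continuous.isClosedEmbedding r.injective).isEmbedding.secondCountableTopology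
  -- continuity of the gauge-transformed link as a function of `(U, h)`
  have hgt : ∀ e : Edge 4 (2 * S + 1), Continuous fun q : GaugeConfig 4 (2 * S + 1) G ×
      (Site 4 (2 * S + 1) → G) => gaugeTransform q.2 q.1 e := by
    intro e
    simp only [gaugeTransform]
    fun_prop
  have hρgt : ∀ e : Edge 4 (2 * S + 1), Continuous fun q : GaugeConfig 4 (2 * S + 1) G ×
      (Site 4 (2 * S + 1) → G) => r.ρ (gaugeTransform q.2 q.1 e) := fun e =>
    r.continuous.comp (hgt e)
  have hcoul : Continuous (uncurry coul) := by
    change Continuous fun q : GaugeConfig 4 (2 * S + 1) G × (Site 4 (2 * S + 1) → G) =>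
      -∑ e : Edge 4 (2 * S + 1),
        (if e.1 0 = 0 ∧ e.2 ≠ 0 then (r.ρ (gaugeTransform q.2 q.1 e)).trace.re else 0)
    refine (continuous_finsetSum _ fun e _ => ?_).neg
    split_ifs
    · exact Complex.continuous_re.comp (Continuous.matrix_trace (hρgt e))
    · exact continuous_const
  have hfro : Continuous fro := by
    change Continuous fun M : Matrix (Fin r.N) (Fin r.N) ℂ => ∑ a, ∑ b, ‖M a b‖ ^ 2
    refine continuous_finsetSum _ fun a _ => continuous_finsetSum _ fun b _ => ?_
    exact ((continuous_apply_apply a b).norm).pow 2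
  have hcov : Continuous (uncurry fun U h => cov U h p) := by
    change Continuous fun q : GaugeConfig 4 (2 * S + 1) G × (Site 4 (2 * S + 1) → G) =>
      (∑ j : Fin 3, fro (∑ y : Fin 3 → ZMod (2 * S + 1),
        Complex.exp (-(2 * Real.pi * Complex.I *
          (∑ i : Fin 3, ((p i).val : ℂ) * ((y i).val : ℂ)) / (2 * S + 1 : ℂ))) •
        ((1 / 2 : ℂ) • (r.ρ (gaugeTransform q.2 q.1 (Fin.cons (0 : ZMod (2 * S + 1)) y, j.succ)) -
          (r.ρ (gaugeTransform q.2 q.1 (Fin.cons (0 : ZMod (2 * S + 1)) y, j.succ)))ᴴ)))) /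
        ((2 * S + 1 : ℝ) ^ 3)
    refine (continuous_finsetSum _ fun j _ => hfro.comp ?_).div_const _
    refine continuous_finsetSum _ fun y _ => ?_
    have h1 : Continuous fun q : GaugeConfig 4 (2 * S + 1) G × (Site 4 (2 * S + 1) → G) =>
        r.ρ (gaugeTransform q.2 q.1 (Fin.cons (0 : ZMod (2 * S + 1)) y, j.succ)) -
          (r.ρ (gaugeTransform q.2 q.1 (Fin.cons (0 : ZMod (2 * S + 1)) y, j.succ)))ᴴ :=
      (hρgt _).sub (Continuous.matrix_conjTranspose (hρgt _))
    exact (h1.const_smul ((1 / 2 : ℂ))).const_smul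
      (Complex.exp (-(2 * Real.pi * Complex.I *
        (∑ i : Fin 3, ((p i).val : ℂ) * ((y i).val : ℂ)) / (2 * S + 1 : ℂ))))
  haveI : Nonempty (Site 4 (2 * S + 1) → G) := ⟨fun _ => 1⟩
  have hmeas : Measurable fun U : GaugeConfig 4 (2 * S + 1) G =>
      ⨆ h : {h : Site 4 (2 * S + 1) → G // ∀ h', coul U h ≤ coul U h'}, cov U h.1 p :=
    measurable_iSup_argmin hcoul hcov
  have hcard : (Fintype.card (Fin 3 → ZMod (2 * S + 1)) : ℝ) = (2 * S + 1 : ℝ) ^ 3 := by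
    rw [Fintype.card_fun, ZMod.card, Fintype.card_fin]; push_cast; ring
  have hsq : ((2 * S + 1 : ℝ) ^ 3 * Real.sqrt r.N) ^ 2 = (r.N : ℝ) * ((2 * S + 1 : ℝ) ^ 3) ^ 2 := by
    rw [mul_pow, Real.sq_sqrt (Nat.cast_nonneg _)]; ring
  have hcov : ∀ U h p, cov U h p ≤ 3 * (r.N : ℝ) * (2 * S + 1 : ℝ) ^ 3 := by
    intro U h p
    have hj : ∀ j : Fin 3, fro (∑ y : Fin 3 → ZMod (2 * S + 1),
        Complex.exp (-(2 * Real.pi * Complex.I *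
          (∑ i : Fin 3, ((p i).val : ℂ) * ((y i).val : ℂ)) / (2 * S + 1 : ℂ))) •
        ((1 / 2 : ℂ) • (r.ρ (gaugeTransform h U (Fin.cons (0 : ZMod (2 * S + 1)) y, j.succ)) -
          (r.ρ (gaugeTransform h U (Fin.cons (0 : ZMod (2 * S + 1)) y, j.succ)))ᴴ))) ≤
        (r.N : ℝ) * ((2 * S + 1 : ℝ) ^ 3) ^ 2 := fun j => by
      have h1 := sum_norm_sq_sum_smul_le (ι := Fin 3 → ZMod (2 * S + 1))
        (fun y => Complex.exp (-(2 * Real.pi * Complex.I *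
          (∑ i : Fin 3, ((p i).val : ℂ) * ((y i).val : ℂ)) / (2 * S + 1 : ℂ))))
        (fun y => (1 / 2 : ℂ) • (r.ρ (gaugeTransform h U (Fin.cons (0 : ZMod (2 * S + 1)) y, j.succ)) -
          (r.ρ (gaugeTransform h U (Fin.cons (0 : ZMod (2 * S + 1)) y, j.succ)))ᴴ))
        (fun y => norm_exp_phase S p y) (fun y => norm_antiHermitianPart_le r _)
      rw [hcard, hsq] at h1
      exact h1
    have hsum : (∑ j : Fin 3, fro (∑ y : Fin 3 → ZMod (2 * S + 1),
        Complex.exp (-(2 * Real.pi * Complex.I *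
          (∑ i : Fin 3, ((p i).val : ℂ) * ((y i).val : ℂ)) / (2 * S + 1 : ℂ))) •
        ((1 / 2 : ℂ) • (r.ρ (gaugeTransform h U (Fin.cons (0 : ZMod (2 * S + 1)) y, j.succ)) -
          (r.ρ (gaugeTransform h U (Fin.cons (0 : ZMod (2 * S + 1)) y, j.succ)))ᴴ)))) ≤
        3 * (r.N : ℝ) * (2 * S + 1 : ℝ) ^ 3 * (2 * S + 1 : ℝ) ^ 3 :=
      calc _ ≤ ∑ _j : Fin 3, (r.N : ℝ) * ((2 * S + 1 : ℝ) ^ 3) ^ 2 :=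
            Finset.sum_le_sum fun j _ => hj j
        _ = 3 * (r.N : ℝ) * (2 * S + 1 : ℝ) ^ 3 * (2 * S + 1 : ℝ) ^ 3 := by
            rw [Finset.sum_const, Finset.card_univ, Fintype.card_fin, nsmul_eq_mul]; push_cast; ring
    exact (div_le_iff₀ (by positivity)).2 hsum
  have hcov0 : ∀ U h p, 0 ≤ cov U h p := fun U h p => by
    refine div_nonneg (Finset.sum_nonneg fun j _ => ?_) (by positivity)
    exact Finset.sum_nonneg fun a _ => Finset.sum_nonneg fun b _ => by positivity
  have hB : 0 ≤ 3 * (r.N : ℝ) * (2 * S + 1 : ℝ) ^ 3 := by positivity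
  haveI := isProbabilityMeasure_wilsonMeasure (d := 4) (L := 2 * S + 1) r.ρ r.continuous β
  refine Integrable.of_bound hmeas.aestronglyMeasurable (3 * (r.N : ℝ) * (2 * S + 1 : ℝ) ^ 3)
    (Eventually.of_forall fun U => ?_)
  have h0 : 0 ≤ ⨆ h : {h : Site 4 (2 * S + 1) → G // ∀ h', coul U h ≤ coul U h'}, cov U h.1 p :=
    Real.iSup_nonneg fun h => hcov0 U h.1 p
  have h1 : (⨆ h : {h : Site 4 (2 * S + 1) → G // ∀ h', coul U h ≤ coul U h'}, cov U h.1 p) ≤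
      3 * (r.N : ℝ) * (2 * S + 1 : ℝ) ^ 3 := Real.iSup_le (fun h => hcov U h.1 p) hB
  show ‖⨆ h : {h : Site 4 (2 * S + 1) → G // ∀ h', coul U h ≤ coul U h'}, cov U h.1 p‖ ≤ _
  rw [Real.norm_eq_abs, abs_of_nonneg h0]
  exact h1

end Crux

end Summit.QuantumFields.YangMills.Theorems.BrascampLiebVacuumSC.Negative

end
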